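import Mathlib.Analysis.Matrix.Order
import Mathlib.LinearAlgebra.Matrix.Kronecker
import Literature.MathematicalPhysics.QuantumLattice.MatrixProductStates
import HarnessLib

/-!
# Discharged facts: matrix product states (`MatrixProductStates`)

`Literature.MathematicalPhysics.QuantumLattice.MatrixProductStates` records the named facts

* `Literature.MathematicalPhysics.QuantumLattice.parentHamiltonian_posSemidef` — *the parent Hamiltonian
  `H = Σ_{x ∈ ℤ/L} h_{x,…,x+ℓ-1}` of an MPS tensor is positive semidefinite*, and
* `Literature.MathematicalPhysics.QuantumLattice.parentHamiltonian_isHermitian` — *it is Hermitian*,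

both elementary consequences of the definition: Fannes–Nachtergaele–Werner, CMP **144** (1992),
§5, Def. 5.4 (p. 468: an interaction exposing `ω` is "a positive operator `h ∈ 𝒜^{⊗ℓ}` … whose
kernel coincides with `𝒢_ℓ`"; here `h = 1 - P_{𝒢_ℓ}`, the orthogonal projection onto `𝒢_ℓᗮ`)
and eq. (5.11) (the finite-size Hamiltonian is the sum of the translates `α_i(h)`; "the kernel of
`H` is clearly equal to the intersection of the kernels of the positive operators `h_k`").

This file proves them: `Literature.MathematicalPhysics.QuantumLattice.parentHamiltonian_posSemidef_holds` and
`Literature.MathematicalPhysics.QuantumLattice.parentHamiltonian_isHermitian_holds`, so that users holding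
`(h : parentHamiltonian_posSemidef)` / `(h : parentHamiltonian_isHermitian)` can discharge the
hypothesis.

It also discharges the two named facts on the propagation of injectivity,

* `Literature.MathematicalPhysics.QuantumLattice.IsInjectiveMPS.mono` — *if the words of a positive length `ℓ` span `M_D(ℂ)`
  then so do the words of every length `ℓ' ≥ ℓ`* (`IsInjectiveMPS.mono_holds`, usable form
  `IsInjectiveMPS.of_le`), and
* `Literature.MathematicalPhysics.QuantumLattice.IsNormalMPS.eventually_isInjectiveMPS` — *a normal tensor is injective for all
  sufficiently large block lengths* (`IsNormalMPS.eventually_isInjectiveMPS_holds`, usable form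
  `IsNormalMPS.eventually`),

following Perez-Garcia–Verstraete–Wolf–Cirac, QIC **7** (2007), §3.2.4 (arXiv p. 8, the remark
between the definition of `Γ_L` and Condition C1): "`Γ_L` is injective iff the set of matrices
`{A_{i_1}⋯A_{i_L}}` spans the entire space of `D × D` matrices. Moreover, if `Σ_i A_i A_i† = 𝟙`
then evidently injectivity of `Γ_L` implies injectivity of `Γ_{L'}` for all `L' ≥ L`." The
vendored fact assumes `0 < ℓ` instead of the normalisation; the proof below
(`IsInjectiveMPS.succ`) needs only that: every `X ∈ M_D(ℂ)` is a combination of words `W` of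
length `ℓ`, so each `A^i X` is a combination of the words `A^i W` of length `ℓ + 1`, and for
`ℓ ≥ 1` every word of length `ℓ` is itself of the form `A^i X`; hence
`M_D(ℂ) = span (words of length ℓ) ≤ span (words of length ℓ + 1)`. Induction on `ℓ'`
(`Nat.le_induction`) gives `mono`, and `Filter.eventually_atTop` with witness `ℓ` gives the
normal case.

Finally it discharges

* `Literature.MathematicalPhysics.QuantumLattice.mpsPeriodic_shift` — *translation invariance of
  the periodic MPS*, `ψ(σ ∘ shift) = ψ(σ)` for `ψ(σ) = tr (A^{σ₀} ⋯ A^{σ_{L-1}})`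
  (`mpsPeriodic_shift_holds`, usable forms `mpsPeriodic_comp_finRotate` and, for an arbitrary
  shift, `mpsPeriodic_comp_finRotate_pow`):

the shifted word is `A^{σ₁} ⋯ A^{σ_{L-1}} A^{σ₀}` and `tr (X Y) = tr (Y X)`
(`Matrix.trace_mul_comm`). This is the cyclic invariance at `B = 𝟙` of the trace formula
`Γ_n(B) = Σ_μ ψ_{μ₁} ⊗ ⋯ ⊗ ψ_{μ_n} tr (B v(μ_n)^* ⋯ v(μ₁)^*)` of Fannes–Nachtergaele–Werner
(1992) §5, eq. (5.5) (p. 465), cf. Perez-Garcia–Verstraete–Wolf–Cirac (2007) §3.2.2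
(translation-invariant MPS with periodic boundary conditions); the statement itself is
elementary.

## Proof

`parentHamiltonian L ℓ A = Σ_x localOp (ringBlock L ℓ x) (onRingBlock L ℓ x (parentLocalTerm ℓ A))`
with `parentLocalTerm ℓ A = projMatrix (mpsRange ℓ A)ᗮ`. Three positivity-preserving steps and
a sum:

1. `projMatrix_posSemidef`: an orthogonal projection matrix `P` is Hermitian
   (`projMatrix_isHermitian`) and idempotent (`projMatrix_mul_self`), so `P = Pᴴ P ≥ 0`
   (Mathlib `Matrix.posSemidef_conjTranspose_mul_self`).
2. `onRingBlock L ℓ x P = P.submatrix e e` is positive by Mathlib `Matrix.PosSemidef.submatrix`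
   (valid for an arbitrary reindexing map `e`, so no hypothesis `ℓ ≤ L` is needed).
3. `posSemidef_localOp`: `localOp X A` *is* the Kronecker product `A ⊗ₖ 𝟙_{Λ∖X}` pulled back
   along the restriction map `σ ↦ (σ|_X, σ|_{Λ∖X})` (`localOp_eq_submatrix_kronecker`, by
   comparing entries), hence positive by Mathlib `Matrix.PosSemidef.kronecker`,
   `Matrix.PosSemidef.one` and `Matrix.PosSemidef.submatrix`.
4. Mathlib `Matrix.posSemidef_sum`.

Hermiticity is `Matrix.PosSemidef.isHermitian`.

## References

* M. Fannes, B. Nachtergaele, R. F. Werner, *Finitely correlated states on quantum spin chains*,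
  Comm. Math. Phys. **144** (1992) 443–490, §5, eq. (5.5), Def. 5.4 and eq. (5.11).
* D. Perez-Garcia, F. Verstraete, M. M. Wolf, J. I. Cirac, *Matrix product state
  representations*, Quantum Inf. Comput. **7** (2007) 401–430, arXiv:quant-ph/0608197, §3.2.4
  (injectivity of `Γ_L`, Condition C1) and §4 (parent Hamiltonians as sums of local projectors).
* O. Bratteli, D. W. Robinson, *Operator Algebras and Quantum Statistical Mechanics II*
  (2nd ed., 1997), §6.2.1 (`𝔄_X ∋ A ↦ A ⊗ 𝟙 ∈ 𝔄_Λ` is a ⋆-monomorphism, hence positive).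
-/

noncomputable section

open Matrix
open scoped Kronecker ComplexOrder

namespace Literature.MathematicalPhysics.QuantumLattice

section QLattice

/-! ### Orthogonal projection matrices are positive -/

section projMatrix

variable {n : Type*} [Fintype n] [DecidableEq n]

/-- The matrix of an orthogonal projection is positive semidefinite: `P = Pᴴ P` since `P` is
Hermitian and idempotent. Tasaki (2020) App. A.2. [folklore] -/
theorem projMatrix_posSemidef (K : Submodule ℂ (EuclideanSpace ℂ n)) :
    (projMatrix K).PosSemidef := by
  have h : projMatrix K = (projMatrix K)ᴴ * projMatrix K := by
    rw [(projMatrix_isHermitian K).eq, projMatrix_mul_self]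
  rw [h]
  exact posSemidef_conjTranspose_mul_self _

end projMatrix

/-! ### `A ↦ A ⊗ 𝟙` preserves positivity -/

section localOp

variable {Λ : Type*} [Fintype Λ] [DecidableEq Λ] {q : ℕ}

/-- `localOp X A` is the Kronecker product `A ⊗ₖ 𝟙_{Λ∖X}` pulled back along the restriction
map `σ ↦ (σ|_X, σ|_{Λ∖X})` (a bijection `(Λ → Fin q) ≃ (X → Fin q) × ((Λ∖X) → Fin q)`); this is
the entrywise formula defining `localOp` read as a reindexed Kronecker product.
Bratteli–Robinson II §6.2.1 (`𝔄_X ∋ A ↦ A ⊗ 𝟙`). [folklore] -/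
theorem localOp_eq_submatrix_kronecker (X : Finset Λ) (A : Matrix (X → Fin q) (X → Fin q) ℂ) :
    localOp X A =
      (A ⊗ₖ (1 : Matrix ({y // y ∉ X} → Fin q) ({y // y ∉ X} → Fin q) ℂ)).submatrix
        (fun σ : TensorIndex Λ q => ((fun x : X => σ x), (fun y : {y // y ∉ X} => σ y)))
        (fun σ : TensorIndex Λ q => ((fun x : X => σ x), (fun y : {y // y ∉ X} => σ y))) := by
  ext σ τ
  have h : (∀ y, y ∉ X → σ y = τ y) ↔
      ((fun y : {y // y ∉ X} => σ y) = fun y : {y // y ∉ X} => τ y) := by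
    simp only [funext_iff, Subtype.forall]
  simp only [localOp_apply, submatrix_apply, kroneckerMap_apply, Matrix.one_apply, mul_ite,
    mul_one, mul_zero]
  exact if_congr h rfl rfl

/-- `A ↦ A ⊗ 𝟙_{Λ∖X}` preserves positivity: if `A` is positive semidefinite then so is
`localOp X A` (Kronecker product with the identity, reindexed).
Bratteli–Robinson II §6.2.1. [folklore] -/
theorem posSemidef_localOp (X : Finset Λ) {A : Matrix (X → Fin q) (X → Fin q) ℂ}
    (hA : A.PosSemidef) : (localOp X A).PosSemidef := by
  rw [localOp_eq_submatrix_kronecker]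
  exact (hA.kronecker Matrix.PosSemidef.one).submatrix _

/-- `A ↦ A ⊗ 𝟙_{Λ∖X}` preserves Hermiticity. Bratteli–Robinson II §6.2.1. [folklore] -/
theorem isHermitian_localOp (X : Finset Λ) {A : Matrix (X → Fin q) (X → Fin q) ℂ}
    (hA : A.IsHermitian) : (localOp X A).IsHermitian := by
  rw [IsHermitian, ← localOp_conjTranspose, hA.eq]

end localOp

/-! ### The parent Hamiltonian is positive -/

variable {q D : ℕ}

/-- The local term `h = 1 - P_{𝒢_ℓ}` of the parent Hamiltonian (the orthogonal projection onto
`𝒢_ℓᗮ`) is positive semidefinite. Fannes–Nachtergaele–Werner (1992) §5, Def. 5.4 ("a positive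
operator `h`"). [cite: FannesNachtergaeleWernerCMP1992, §5 Def. 5.4] -/
theorem parentLocalTerm_posSemidef (ℓ : ℕ) (A : MPSTensor q D) :
    (parentLocalTerm ℓ A).PosSemidef :=
  projMatrix_posSemidef _

/-- Transporting an `ℓ`-site operator to a block of the ring preserves positivity (a `submatrix`
along the relabelling of configurations; no hypothesis `ℓ ≤ L`). [folklore] -/
theorem posSemidef_onRingBlock (L ℓ : ℕ) (x : ZMod L) {P : Op (Fin ℓ) q} (hP : P.PosSemidef) :
    (onRingBlock L ℓ x P).PosSemidef :=
  hP.submatrix _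

/-- **Discharge of `parentHamiltonian_posSemidef`.** The parent Hamiltonian
`H = Σ_{x ∈ ℤ/L} h_{x,…,x+ℓ-1}` is positive semidefinite: each term is the positive operator
`h = 1 - P_{𝒢_ℓ}` (`parentLocalTerm_posSemidef`) transported to a block (`posSemidef_onRingBlock`)
and tensored with the identity (`posSemidef_localOp`), and a finite sum of positive semidefinite
matrices is positive semidefinite. Fannes–Nachtergaele–Werner (1992) §5, Def. 5.4 and
eq. (5.11) (p. 468). [cite: FannesNachtergaeleWernerCMP1992, §5 Def. 5.4 and eq. (5.11)] -/
theorem parentHamiltonian_posSemidef_holds : parentHamiltonian_posSemidef (q := q) (D := D) := by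
  intro L _ ℓ A
  unfold parentHamiltonian
  exact posSemidef_sum _ fun x _ =>
    posSemidef_localOp _ (posSemidef_onRingBlock L ℓ x (parentLocalTerm_posSemidef ℓ A))

/-- **Discharge of `parentHamiltonian_isHermitian`.** The parent Hamiltonian is Hermitian
(it is positive semidefinite, `parentHamiltonian_posSemidef_holds`).
Fannes–Nachtergaele–Werner (1992) §5. [cite: FannesNachtergaeleWernerCMP1992, §5 Def. 5.4 and eq. (5.11)] -/
theorem parentHamiltonian_isHermitian_holds : parentHamiltonian_isHermitian (q := q) (D := D) :=
  fun L _ ℓ A => (parentHamiltonian_posSemidef_holds L ℓ A).isHermitian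

/-! ### Injectivity propagates to larger block lengths -/

/-- Prepending a letter multiplies the word product on the left:
`A^{i} · (A^{w₀} ⋯ A^{w_{k-1}}) = A^{i} A^{w₀} ⋯ A^{w_{k-1}}` (the word product of
`Fin.cons i w`). [folklore] -/
theorem wordProduct_cons {k : ℕ} (A : MPSTensor q D) (i : Fin q) (w : Fin k → Fin q) :
    wordProduct A (Fin.cons i w : Fin (k + 1) → Fin q) = A i * wordProduct A w := by
  simp [wordProduct, List.ofFn_succ]

/-- One step of the propagation of injectivity: if the words of a *positive* length `ℓ` span
`M_D(ℂ)`, then so do the words of length `ℓ + 1`. Every matrix `X` is a combination of words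
`W` of length `ℓ`, so `A^i X` is a combination of the words `A^i W` of length `ℓ + 1`; and since
`ℓ ≥ 1` every word of length `ℓ` is itself of the form `A^i X`, so the words of length `ℓ`
(which span) lie in the span of the words of length `ℓ + 1`. (The printed remark assumes the
normalisation `Σ_i A^i (A^i)† = 𝟙`; the argument above shows that `0 < ℓ` suffices, because
injectivity at a positive length already forces `Σ_i A^i M_D(ℂ) = M_D(ℂ)`.)
Perez-Garcia–Verstraete–Wolf–Cirac (2007) §3.2.4, remark after the definition of `Γ_L` and
before Condition C1 ("injectivity of `Γ_L` implies injectivity of `Γ_{L'}` for all `L' ≥ L`";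
arXiv p. 8). [cite: PerezGarciaVerstraeteWolfCiracQIC2007, §3.2.4 (remark before Condition C1)] -/
theorem IsInjectiveMPS.succ {A : MPSTensor q D} {ℓ : ℕ} (h : IsInjectiveMPS A ℓ) (hℓ₀ : 0 < ℓ) :
    IsInjectiveMPS A (ℓ + 1) := by
  -- every `A i * X` lies in the span of the words of length `ℓ + 1`
  have step : ∀ (i : Fin q) (X : Matrix (Fin D) (Fin D) ℂ),
      A i * X ∈ Submodule.span ℂ (Set.range (wordProduct (ℓ := ℓ + 1) A)) := by
    intro i X
    have hX : X ∈ Submodule.span ℂ (Set.range (wordProduct (ℓ := ℓ) A)) := by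
      rw [h]; exact Submodule.mem_top
    induction hX using Submodule.span_induction with
    | mem x hx =>
      obtain ⟨w, rfl⟩ := hx
      exact Submodule.subset_span ⟨Fin.cons i w, wordProduct_cons A i w⟩
    | zero => simp
    | add x y _ _ hx hy => rw [mul_add]; exact add_mem hx hy
    | smul c x _ hx => rw [mul_smul_comm]; exact Submodule.smul_mem _ c hx
  -- the words of length `ℓ = k + 1` are of the form `A i * X`
  obtain ⟨k, rfl⟩ : ∃ k, ℓ = k + 1 := ⟨ℓ - 1, by omega⟩
  unfold IsInjectiveMPS at h ⊢
  rw [eq_top_iff, ← h, Submodule.span_le]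
  rintro _ ⟨w, rfl⟩
  rw [← Fin.cons_self_tail w, wordProduct_cons]
  exact step _ _

/-- **Discharge of `IsInjectiveMPS.mono`.** Injectivity with a positive block length `ℓ`
propagates to every block length `ℓ' ≥ ℓ` (induction on `ℓ'` with `IsInjectiveMPS.succ`).
Perez-Garcia–Verstraete–Wolf–Cirac (2007) §3.2.4, remark before Condition C1 (arXiv p. 8);
the hypothesis `0 < ℓ` replaces the normalisation `Σ_i A^i (A^i)† = 𝟙` assumed there.
[cite: PerezGarciaVerstraeteWolfCiracQIC2007, §3.2.4 (remark before Condition C1)] -/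
theorem IsInjectiveMPS.mono_holds : IsInjectiveMPS.mono (q := q) (D := D) := by
  intro A ℓ ℓ' h hℓ₀ hℓ
  induction ℓ', hℓ using Nat.le_induction with
  | base => exact h
  | succ n hn ih => exact ih.succ (hℓ₀.trans_le hn)

/-- Usable form of `IsInjectiveMPS.mono_holds`: `IsInjectiveMPS A ℓ → 0 < ℓ → ℓ ≤ ℓ' →
IsInjectiveMPS A ℓ'`. Perez-Garcia–Verstraete–Wolf–Cirac (2007) §3.2.4.
[cite: PerezGarciaVerstraeteWolfCiracQIC2007, §3.2.4 (remark before Condition C1)] -/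
theorem IsInjectiveMPS.of_le {A : MPSTensor q D} {ℓ ℓ' : ℕ} (h : IsInjectiveMPS A ℓ)
    (hℓ₀ : 0 < ℓ) (hℓ : ℓ ≤ ℓ') : IsInjectiveMPS A ℓ' :=
  IsInjectiveMPS.mono_holds h hℓ₀ hℓ

/-- **Discharge of `IsNormalMPS.eventually_isInjectiveMPS`.** A normal tensor (injective for
some positive block length `ℓ`, Condition C1 of Perez-Garcia–Verstraete–Wolf–Cirac (2007)
§3.2.4 with `L₀ ≥ 1`) is injective for all sufficiently large block lengths, namely for all
`ℓ' ≥ ℓ` (`IsInjectiveMPS.mono_holds`). [folklore] -/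
theorem IsNormalMPS.eventually_isInjectiveMPS_holds :
    IsNormalMPS.eventually_isInjectiveMPS (q := q) (D := D) := by
  intro A h
  obtain ⟨ℓ, hℓ₀, hℓ⟩ := h
  exact Filter.eventually_atTop.2 ⟨ℓ, fun ℓ' h' => IsInjectiveMPS.mono_holds hℓ hℓ₀ h'⟩

/-- Usable form of `IsNormalMPS.eventually_isInjectiveMPS_holds`. [folklore] -/
theorem IsNormalMPS.eventually {A : MPSTensor q D} (h : IsNormalMPS A) :
    ∀ᶠ ℓ in Filter.atTop, IsInjectiveMPS A ℓ :=
  IsNormalMPS.eventually_isInjectiveMPS_holds h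

/-! ### Translation invariance of the periodic MPS -/

/-- **Discharge of `mpsPeriodic_shift`** (translation invariance of the periodic MPS,
`ψ(σ ∘ shift) = ψ(σ)`). For `L = 0` both sides are the amplitude of the unique (empty)
configuration. For `L = n + 1` the shifted word is `A^{σ₁} ⋯ A^{σ_n} A^{σ₀}` (`List.ofFn_succ'`
and `finRotate (n+1) i = i + 1`) while the original word is `A^{σ₀} A^{σ₁} ⋯ A^{σ_n}`
(`List.ofFn_succ`), and the two traces agree by cyclicity `tr (X Y) = tr (Y X)`
(`Matrix.trace_mul_comm`). This is the cyclic invariance at `B = 𝟙` of the trace formula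
`Γ_n(B) = Σ_μ ψ_{μ₁} ⊗ ⋯ ⊗ ψ_{μ_n} tr (B v(μ_n)^* ⋯ v(μ₁)^*)`, Fannes–Nachtergaele–Werner (1992)
§5, eq. (5.5) (p. 465); Perez-Garcia–Verstraete–Wolf–Cirac (2007) §3.2.2 (translation-invariant
MPS with periodic boundary conditions). The statement itself is elementary.
[cite: FannesNachtergaeleWernerCMP1992, §5 eq. (5.5)] -/
theorem mpsPeriodic_shift_holds : mpsPeriodic_shift (q := q) (D := D) := by
  intro L A σ
  cases L with
  | zero => exact congrArg (mpsPeriodic 0 A) (funext fun i => i.elim0)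
  | succ n =>
    simp only [mpsPeriodic_apply, wordProduct]
    rw [List.ofFn_succ', List.ofFn_succ]
    simp only [Function.comp_apply, finRotate_apply, Fin.coeSucc_eq_succ, Fin.last_add_one,
      List.concat_eq_append, List.prod_append, List.prod_cons, List.prod_nil, mul_one]
    exact Matrix.trace_mul_comm _ _

/-- Usable form of `mpsPeriodic_shift_holds`: `ψ(σ ∘ finRotate L) = ψ(σ)`.
Fannes–Nachtergaele–Werner (1992) §5, eq. (5.5). [cite: FannesNachtergaeleWernerCMP1992, §5 eq. (5.5)] -/
theorem mpsPeriodic_comp_finRotate (L : ℕ) (A : MPSTensor q D) (σ : TensorIndex (Fin L) q) :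
    mpsPeriodic L A (σ ∘ finRotate L) = mpsPeriodic L A σ :=
  mpsPeriodic_shift_holds L A σ

/-- Invariance of the periodic MPS under an arbitrary translation `x ↦ x + k` of the ring of `L`
sites (the `k`-th power of the elementary shift), by iterating `mpsPeriodic_comp_finRotate`.
Fannes–Nachtergaele–Werner (1992) §5, eq. (5.5). [cite: FannesNachtergaeleWernerCMP1992, §5 eq. (5.5)] -/
theorem mpsPeriodic_comp_finRotate_pow (L : ℕ) (A : MPSTensor q D) (σ : TensorIndex (Fin L) q)
    (k : ℕ) : mpsPeriodic L A (σ ∘ ⇑(finRotate L ^ k)) = mpsPeriodic L A σ := by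
  induction k with
  | zero => simp
  | succ k ih =>
    rw [pow_succ, Equiv.Perm.coe_mul, ← Function.comp_assoc, mpsPeriodic_comp_finRotate, ih]

end QLattice

end Literature.MathematicalPhysics.QuantumLattice
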